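import Summits.QuantumFields.BalabanUV.T4Continuum.Support.VectorLineTransportFrame
import Summits.QuantumFields.BalabanUV.T4Continuum.Support.VariationalVectorOneStepRepair

/-!
# T⁴ programme, spine node NE2 (U1a), lane P2 — leaf V-ONE-1F for E-valued 1-forms, file 9: GENERAL LINE CARRIERS NEAR THE FRAME-ADAPTED ONES,
# the intermediate leaf V-UB DISCHARGED BY NAME (model level; cell `pub-balaban`)

NE2 formalisation swarm, leaf prover 01 GEN 6 (`prover-b2b-balaban-t4-ne2-formalise-leaf-01-g6-0`), register row P2-sup, leaf V-ONE-1F (journal INTENT for this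
file 2026-08-20 14:34Z).  File 6 (`VariationalVectorOneStepRepair.blockSpin_QT_le`, p219957) proved the curl half of `hONE` for ANY line-transport datum `T` with
`‖T − frameT U′ Rc‖ ≤ γ`, modulo ONE displayed hypothesis `hUB1` — leaf V-UB for `Q_T` at the intermediate level, in the tree's shape.  leaf-03-g4's
`VectorBlockTrialForm.exists_ubV_nearFrame_ScV` (`Support/VectorLineTransportFrame`, p220640) IS that hypothesis one scale up (`n ↦ L`, `M ↦ fine n M`,
`R ↦ R′`, `G ↦ G′`) under unitary frames, a star-shaped in-block 0-form defect `w`, the smallness `κ_V(d,L)⁻¹·γ < 1`, finite-dimensional `E` and (GF1′)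
`G′ ≤ C_G·roughV R′ + C₀·nsqV`, with `Λ₁ := lamV d (L·w) C_G (L²C₀) ∕ (1 − κ_V⁻¹γ)²`.  This file is the one-line composition:

 * **`blockSpin_QT_le_nearFrame`** — `blockSpin (QvL L (fine n M) T) (SfV n L M R′ 0) W ≤ (√(ScV n M Rc G W + 4(d+26)(L∕n²)·ρ_V W) + δ′_T·√(qWV n M W))²`,
   `δ′_T = nL√(d(50p²∕L + (32(1+d²)+400)m²)∕2) + nγ√(Λ₁·(4(1+d²)+50))`, with NO displayed V-UB hypothesis left: the only functional-analytic input on `G′` is (GF1′).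
   The TAXI-DATA instance (sizes `m`, `p`, `γ`, `w` from contour transports, `T := lineT (taxiTv R′) R′`) is leaf-04-g4's
   `VariationalColourTaxiTransport.blockSpin_lineT_taxi_le` (module `Support/VariationalVectorTaxiUpperBound`, p221223, proved independently from their
   part 4 — no dependency either way); this file is the
   carrier-generic statement for any near-frame `T`.

HONEST FRAMING (T4-DAG p. 1).  Model level: transports, frames, forms are DATA (no identification with Bałaban's `U(Γ)`, `Q̄`, minimisers — c5); [folklore]
composition of two tree theorems imported BY NAME; no `def`, no `def … : Prop`, no `sorry`; axioms standard.  Leaf V-ONE NOT closed beyond what files 5–8 say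
(full fine form only modulo (SLICE′), file 8); NE2 NOT proved; spine PROVED 0∕9 unchanged; rung (B)+1 finite T⁴ — NOT infinite volume, NOT mass gap, NOT Clay.
HONEST DEPENDENCY (cell, verbatim): continuum YM on T⁴ ⇐ BetaPertH ∧ nine spine estimates (0/9 proved); BetaPertH ⇐ (D1) ∧ (D4) ∧ CAP+tail; G-an2-4 gates
asym, D1 and NE2/3/4.
-/

noncomputable section

namespace Summit.QuantumFields.BalabanUV.T4Continuum.VariationalVectorOneStepNearFrame

open Literature.MathematicalPhysics.QuantumFieldTheory.Balaban1983to89.B5Prop11Plancherel (Tor fine unitVec)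
open Literature.MathematicalPhysics.QuantumFieldTheory.Balaban1983to89.B5Block118 (bpt)
open Summit.QuantumFields.BalabanUV.T4Continuum.VariationalTransfer (blockSpin)
open Summit.QuantumFields.BalabanUV.T4Continuum.VectorBlockTrialForm (nsqV QvL kappaV roughV exists_ubV_nearFrame_ScV)
open Summit.QuantumFields.BalabanUV.T4Continuum.VariationalVectorForm (ScV SfV qWV lamV lamV_nonneg)
open Summit.QuantumFields.BalabanUV.T4Continuum.VariationalVectorInterpolant (frameT)
open Summit.QuantumFields.BalabanUV.T4Continuum.VariationalVectorOneStep (plaq)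
open Summit.QuantumFields.BalabanUV.T4Continuum.VariationalVectorOneStepPhys (rhoV)
open Summit.QuantumFields.BalabanUV.T4Continuum.VariationalVectorOneStepRepair (blockSpin_QT_le)

variable {d : ℕ} (n L : ℕ) [NeZero n] [NeZero L] (M : Fin d → ℕ) [hM : ∀ μ, NeZero (M μ)]
variable {E : Type*} [NormedAddCommGroup E] [InnerProductSpace ℂ E] [CompleteSpace E] [FiniteDimensional ℂ E]

/-- **LEAF V-ONE-1F, CURL HALF, GENERAL LINE CARRIERS NEAR `frameT` — NO DISPLAYED V-UB LEFT.**  Data: site frames `U′` (unitary), coarse bond transports `Rc`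
(unitary, plaquette size `≤ p`), fine bond transports `R′` (contractions; frame defects `≤ m` in-block and across block faces in file 5's letters, and `≤ w` in
leaf-03-g4's star-shape letter), a line-transport datum `T` with `‖T − frameT U′ Rc‖ ≤ γ`, `κ_V(d,L)⁻¹γ < 1`, `1 ≤ d`, coarse `G ≥ 0`, fine `G′ ≥ 0` with (GF1′)
`G′ ≤ C_G·roughV R′ + C₀·nsqV`.  THEN for every coarse 1-form `W`:
`blockSpin (QvL L (fine n M) T) (SfV n L M R′ 0) W ≤ (√(ScV n M Rc G W + 4(d+26)(L∕n²)·rhoV n M Rc W) + (nL√(d(50p²∕L + (32(1+d²)+400)m²)∕2)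
  + nγ√(Λ₁(4(1+d²)+50)))·√(qWV n M W))²`, `Λ₁ = lamV d (L·w) C_G (L²C₀) ∕ (1 − κ_V⁻¹γ)²` — file 6's `blockSpin_QT_le` with `hUB1 :=
VectorBlockTrialForm.exists_ubV_nearFrame_ScV L (fine n M) …` (p220640). [folklore] -/
theorem blockSpin_QT_le_nearFrame {U' : Tor (fine L (fine n M)) → (E →L[ℂ] E)} (hU : ∀ x, U' x ∈ unitary (E →L[ℂ] E))
    {Rc : Tor (fine n M) → Fin d → (E →L[ℂ] E)} (hRc1 : ∀ y μ, Rc y μ ∈ unitary (E →L[ℂ] E)) {m p : ℝ} (hm : 0 ≤ m)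
    {R' : Tor (fine L (fine n M)) → Fin d → (E →L[ℂ] E)} (hR : ∀ x ν, ‖R' x ν‖ ≤ 1)
    (hin : ∀ (y : Tor (fine n M)) (j : Fin d → Fin L) (μ : Fin d), (j μ : ℕ) + 1 < L →
      ‖R' (bpt L (fine n M) y j) μ * star (U' (bpt L (fine n M) y j + unitVec (fine L (fine n M)) μ)) - star (U' (bpt L (fine n M) y j))‖ ≤ m)
    (hcross : ∀ (y : Tor (fine n M)) (j : Fin d → Fin L) (μ : Fin d), (j μ : ℕ) + 1 = L →
      ‖R' (bpt L (fine n M) y j) μ * star (U' (bpt L (fine n M) y j + unitVec (fine L (fine n M)) μ))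
        - star (U' (bpt L (fine n M) y j)) * Rc y μ‖ ≤ m)
    (hp : ∀ y μ ν, ‖plaq (fine n M) Rc y μ ν‖ ≤ p) {G : (Tor (fine n M) → Fin d → E) → ℝ} (hG0 : ∀ W, 0 ≤ G W)
    {G' : (Tor (fine L (fine n M)) → Fin d → E) → ℝ} (hG0' : ∀ W', 0 ≤ G' W')
    {T : Tor (fine n M) → (Fin d → Fin L) → Fin L → Fin d → (E →L[ℂ] E)} {γ : ℝ} (hγ : 0 ≤ γ)
    (hT : ∀ y j t ν, ‖T y j t ν - frameT L (fine n M) U' Rc y j t ν‖ ≤ γ) (hc : (kappaV d L)⁻¹ * γ < 1)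
    {w : ℝ} (hw0 : 0 ≤ w)
    (hw : ∀ (y : Tor (fine n M)) (j : Fin d → Fin L) (ν : Fin d), (j ν : ℕ) + 1 < L →
      ‖R' (bpt L (fine n M) y j) ν * star (U' (bpt L (fine n M) y j + unitVec (fine L (fine n M)) ν)) * U' (bpt L (fine n M) y j) - 1‖ ≤ w)
    (hd : 1 ≤ d) {CG C₀ : ℝ} (hCG : 0 ≤ CG) (hC₀ : 0 ≤ C₀)
    (hG : ∀ W', G' W' ≤ CG * roughV L (fine n M) R' W' + C₀ * nsqV (fine L (fine n M)) W') (W : Tor (fine n M) → Fin d → E) :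
    blockSpin (QvL L (fine n M) T) (SfV n L M R' (fun _ => 0)) W
      ≤ (Real.sqrt (ScV n M Rc G W + 4 * ((d : ℝ) + 26) * ((L : ℝ) / (n : ℝ) ^ 2) * rhoV n M Rc W)
          + ((n : ℝ) * L * Real.sqrt (d * (50 * p ^ 2 / L + (32 * (1 + (d : ℝ) ^ 2) + 400) * m ^ 2) / 2)
              + (n : ℝ) * γ * Real.sqrt (lamV d (L * w) CG ((L : ℝ) ^ 2 * C₀) / (1 - (kappaV d L)⁻¹ * γ) ^ 2 * (4 * (1 + (d : ℝ) ^ 2) + 50)))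
            * Real.sqrt (qWV n M W)) ^ 2 :=
  blockSpin_QT_le n L M hU hRc1 hm hin hcross hp hG0 hG0' hγ hT (div_nonneg (lamV_nonneg hCG (by positivity)) (sq_nonneg _))
    (exists_ubV_nearFrame_ScV L (fine n M) hU hT hc hR hw0 hw hd hCG hC₀ hG) W

end Summit.QuantumFields.BalabanUV.T4Continuum.VariationalVectorOneStepNearFrame

end
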